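import Mathlib
import Summits.MatrixMultiplication.MatrixMultiplication.Theorems.SubgroupIdentityDesigns.Negative.NormaliserImages
import Summits.MatrixMultiplication.MatrixMultiplication.Theorems.SubgroupIdentityDesigns.Negative.FullImageSplit
import Summits.MatrixMultiplication.MatrixMultiplication.Theorems.SubgroupIdentityDesigns.Negative.SingerLineTransitive

/-!
# `𝔽_p`-algebra for Dickson's theorem (discriminants, square roots in `𝔽_p[g]`, Cartan shapes)

Route `LevelGradedCohnUmans`, crux `SubgroupIdentityDesigns` (stmt-MatrixMultiplication-14079), cell
`(m,k) = (2,1)`.  VALUE = THEOREM (elementary linear algebra over `𝔽_p`, `p` odd), NOT summit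
progress.  Rational half of an in-Lean proof of the named hypothesis `DicksonList p n`
(`DicksonReduction.lean`): `disc_ne_zero_of_pfree` (a non-scalar element of a subgroup of order
prime to `p` has `tr² ≠ 4 det`), `exists_sqrt_smul_one` (`𝔽_p[g]` contains `s` with `s² = n·1` when
`disc g` and `n` are non-squares), `exists_conj_stdSinger` + `isSingerNormal_of_(anti)comm_std`
(the (anti-)commutant of `[[0,n],[1,0]]` is `IsSingerNormal n`), `isMonomial_conj_of_eigen/_swap`
(rational eigenbases give the monomial shapes).
-/

set_option linter.dupNamespace false

noncomputable section

open scoped BigOperators Classical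

open Summit.MatrixMultiplication.MatrixMultiplication.Theorems.LieRankDesigns.Negative (GLm Mat)
open Literature.NumberTheory.EllipticCurves.BinaryQuartic (two_ne_zero_zmod)

namespace Summit.MatrixMultiplication.MatrixMultiplication.Theorems.SubgroupIdentityDesigns.Negative

section PfreeAlgebra

variable {p : ℕ} [hp : Fact p.Prime]

/-! ### Scalars, Cayley–Hamilton, discriminant -/

/-- Entry test for scalar matrices. -/
theorem mem_range_scalarHom_iff (g : GLm p 2) :
    g ∈ (scalarHom p 2).range ↔
      (g : Mat p 2) 0 1 = 0 ∧ (g : Mat p 2) 1 0 = 0 ∧ (g : Mat p 2) 1 1 = (g : Mat p 2) 0 0 := by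
  constructor
  · rintro ⟨u, rfl⟩
    obtain ⟨h00, h01, h10, h11⟩ := scalarHom_entries (p := p) u
    exact ⟨h01, h10, by rw [h11, h00]⟩
  · rintro ⟨h01, h10, h11⟩
    have hdet : ((g : GLm p 2) : Mat p 2).det ≠ 0 := by
      rw [← Matrix.GeneralLinearGroup.val_det_apply]; exact Units.ne_zero _
    rw [Matrix.det_fin_two, h01, h11, zero_mul, sub_zero] at hdet
    have h0 : (g : Mat p 2) 0 0 ≠ 0 := fun h => hdet (by rw [h, mul_zero])
    refine ⟨Units.mk0 _ h0, ?_⟩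
    obtain ⟨e00, e01, e10, e11⟩ := scalarHom_entries (p := p) (Units.mk0 _ h0)
    exact gl2_ext (by rw [e00, Units.val_mk0]) (by rw [e01, h01]) (by rw [e10, h10])
      (by rw [e11, h11, Units.val_mk0])

/-- Cayley–Hamilton for `2 × 2` matrices over a commutative ring. -/
theorem mat2_sq_eq {R : Type*} [CommRing R] (M : Matrix (Fin 2) (Fin 2) R) :
    M * M = (M 0 0 + M 1 1) • M - (M 0 0 * M 1 1 - M 0 1 * M 1 0) • (1 : Matrix (Fin 2) (Fin 2) R) := by
  ext i j
  fin_cases i <;> fin_cases j <;>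
    simp [Matrix.mul_apply, Fin.sum_univ_two] <;> ring

/-- The discriminant `tr² - 4 det` of a `2 × 2` matrix. -/
def disc {R : Type*} [CommRing R] (M : Matrix (Fin 2) (Fin 2) R) : R :=
  (M 0 0 + M 1 1) ^ 2 - 4 * (M 0 0 * M 1 1 - M 0 1 * M 1 0)

/-- `disc` commutes with ring maps. -/
theorem disc_map {R S : Type*} [CommRing R] [CommRing S] (f : R →+* S)
    (M : Matrix (Fin 2) (Fin 2) R) : disc (M.map f) = f (disc M) := by
  simp [disc, Matrix.map_apply, map_ofNat]

/-- `(1 + m)^k = 1 + k m` for a square-zero matrix `m`. -/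
theorem one_add_pow_of_sq_zero {R : Type*} [CommRing R] {m : Matrix (Fin 2) (Fin 2) R}
    (hm : m * m = 0) (k : ℕ) : (1 + m) ^ k = 1 + (k : R) • m := by
  induction k with
  | zero => simp
  | succ k ih =>
    rw [pow_succ, ih, add_mul, one_mul, mul_add, mul_one, smul_mul_assoc, hm, smul_zero, add_zero,
      Nat.cast_succ, add_smul, one_smul]
    abel

/-- **A non-scalar element of a subgroup of order prime to `p` has non-zero discriminant**
(`p` odd): otherwise `g = λ(1 + m)` with `m ≠ 0`, `m² = 0`, and `g^{|H|} = 1` forces `p ∣ |H|`. -/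
theorem disc_ne_zero_of_pfree (hp2 : p ≠ 2) {H : Subgroup (GLm p 2)} (hH : ¬ p ∣ Nat.card H)
    {g : GLm p 2} (hg : g ∈ H) (hns : g ∉ (scalarHom p 2).range) :
    disc (g : Mat p 2) ≠ 0 := by
  intro hΔ
  have h2 : (2 : ZMod p) ≠ 0 := two_ne_zero_zmod hp2
  set M : Mat p 2 := (g : Mat p 2) with hM
  set t : ZMod p := M 0 0 + M 1 1 with ht
  set d : ZMod p := M 0 0 * M 1 1 - M 0 1 * M 1 0 with hd
  set l : ZMod p := t / 2 with hl
  have htl : t = 2 * l := by rw [hl]; field_simp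
  have hdl : d = l * l := by
    have : t ^ 2 - 4 * d = 0 := hΔ
    rw [htl] at this
    have h4 : (4 : ZMod p) ≠ 0 := by
      have : (4 : ZMod p) = 2 * 2 := by norm_num
      rw [this]; exact mul_ne_zero h2 h2
    have e : 4 * (l * l - d) = 0 := by rw [← this]; ring
    rcases mul_eq_zero.mp e with e | e
    · exact (h4 e).elim
    · exact (sub_eq_zero.mp e).symm
  have hdet : M.det ≠ 0 := by
    rw [hM, ← Matrix.GeneralLinearGroup.val_det_apply]; exact Units.ne_zero _
  have hl0 : l ≠ 0 := by
    intro h0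
    apply hdet
    rw [Matrix.det_fin_two, ← hd, hdl, h0, mul_zero]
  -- `m := l⁻¹ g - 1` squares to zero
  set m : Mat p 2 := l⁻¹ • M - 1 with hm
  have hMeq : M = l • (1 + m) := by
    rw [hm, smul_add, smul_sub, smul_smul, mul_inv_cancel₀ hl0, one_smul]; abel
  have hCH := mat2_sq_eq M
  rw [← ht, ← hd, htl, hdl] at hCH
  have hm2 : m * m = 0 := by
    rw [hm, sub_mul, mul_sub, mul_sub, smul_mul_smul_comm, hCH, mul_one, one_mul, mul_one]
    simp only [smul_sub, smul_smul]
    have e1 : l⁻¹ * l⁻¹ * (2 * l) = 2 * l⁻¹ := by field_simp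
    have e2 : l⁻¹ * l⁻¹ * (l * l) = 1 := by field_simp
    rw [e1, e2, one_smul, mul_smul, two_smul]
    abel
  -- `m ≠ 0` since `g` is not scalar
  have hm0 : m ≠ 0 := by
    intro h0
    apply hns
    rw [mem_range_scalarHom_iff]
    have e : M = l • (1 : Mat p 2) := by rw [hMeq, h0, add_zero]
    refine ⟨?_, ?_, ?_⟩
    · show M 0 1 = 0
      rw [e]; simp
    · show M 1 0 = 0
      rw [e]; simp
    · show M 1 1 = M 0 0
      rw [e]; simp
  -- `g ^ |H| = 1`
  have hpow : M ^ Nat.card H = 1 := by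
    have h1 : (⟨g, hg⟩ : H) ^ Nat.card H = 1 := pow_card_eq_one'
    have h1' : g ^ Nat.card H = 1 := by
      have := congrArg (fun x : H => (x : GLm p 2)) h1
      simpa only [Subgroup.coe_pow, Subgroup.coe_mk, Subgroup.coe_one] using this
    have h3 := congrArg (fun x : GLm p 2 => (x : Mat p 2)) h1'
    simpa only [Units.val_pow_eq_pow_val, Units.val_one, hM] using h3
  rw [hMeq, smul_pow, one_add_pow_of_sq_zero hm2] at hpow
  -- traces: `tr m = 0`, so `l ^ |H| = 1`
  have htrm : m 0 0 + m 1 1 = 0 := by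
    have e : m 0 0 + m 1 1 = l⁻¹ * t - 2 := by
      rw [hm, ht]; simp [Matrix.sub_apply, Matrix.smul_apply]; ring
    rw [e, htl]; field_simp; ring
  have hlc : l ^ Nat.card H = 1 := by
    have e := congrArg (fun A : Mat p 2 => A 0 0 + A 1 1) hpow
    simp only [Matrix.smul_apply, Matrix.add_apply, Matrix.one_apply_eq, smul_eq_mul] at e
    have e' : l ^ Nat.card H * (2 + (Nat.card H : ZMod p) * (m 0 0 + m 1 1)) = 2 := by
      linear_combination e
    rw [htrm, mul_zero, add_zero] at e'
    have := mul_right_cancel₀ h2 (e'.trans (one_mul _).symm)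
    exact this
  rw [hlc, one_smul, add_eq_left, smul_eq_zero] at hpow
  rcases hpow with hc | hc
  · exact hH ((ZMod.natCast_eq_zero_iff _ _).mp hc)
  · exact hm0 hc

/-! ### Squares in `𝔽_p` and square roots in `𝔽_p[g]` -/

/-- The product of two non-squares of `𝔽_p` is a square. -/
theorem isSquare_mul_of_nonsquare {u v : ZMod p} (hu : ∀ y : ZMod p, y * y ≠ u)
    (hv : ∀ y : ZMod p, y * y ≠ v) : IsSquare (u * v) := by
  have hu0 : u ≠ 0 := fun h => hu 0 (by rw [h, mul_zero])
  have hv0 : v ≠ 0 := fun h => hv 0 (by rw [h, mul_zero])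
  have hu' : ¬ IsSquare u := fun ⟨y, hy⟩ => hu y hy.symm
  have hv' : ¬ IsSquare v := fun ⟨y, hy⟩ => hv y hy.symm
  rw [ZMod.euler_criterion p hu0] at hu'
  rw [ZMod.euler_criterion p hv0] at hv'
  have eu := (ZMod.pow_div_two_eq_neg_one_or_one p hu0).resolve_left hu'
  have ev := (ZMod.pow_div_two_eq_neg_one_or_one p hv0).resolve_left hv'
  rw [ZMod.euler_criterion p (mul_ne_zero hu0 hv0), mul_pow, eu, ev]
  ring

/-- The inverse of a non-square is a non-square. -/
theorem nonsquare_inv {u : ZMod p} (hu : ∀ y : ZMod p, y * y ≠ u) :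
    ∀ y : ZMod p, y * y ≠ u⁻¹ := by
  intro y hy
  have hu0 : u ≠ 0 := fun h => hu 0 (by rw [h, mul_zero])
  have hy0 : y ≠ 0 := by
    intro h; rw [h, mul_zero] at hy; exact inv_ne_zero hu0 hy.symm
  apply hu y⁻¹
  rw [← mul_inv, hy, inv_inv]

/-- `(a·1 + b·M)² = a²·1 + 2ab·M + b²·M²`. -/
theorem sq_affine {R : Type*} [CommRing R] (a b : R) (M : Matrix (Fin 2) (Fin 2) R) :
    (a • (1 : Matrix (Fin 2) (Fin 2) R) + b • M) * (a • (1 : Matrix (Fin 2) (Fin 2) R) + b • M)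
      = (a * a) • (1 : Matrix (Fin 2) (Fin 2) R) + (2 * a * b) • M + (b * b) • (M * M) := by
  rw [add_mul, mul_add, mul_add, smul_mul_smul_comm, smul_mul_smul_comm, smul_mul_smul_comm,
    smul_mul_smul_comm, one_mul, mul_one, one_mul]
  module

/-- **Square roots of non-squares in `𝔽_p[g]`.**  If `g` is not scalar and `disc g` is a
non-square, then for every non-square `n` there are `a, b ∈ 𝔽_p`, `b ≠ 0`, with
`(a·1 + b·g)² = n·1`. -/
theorem exists_sqrt_smul_one (hp2 : p ≠ 2) {n : ZMod p} (hn : ∀ y : ZMod p, y * y ≠ n)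
    (M : Mat p 2) (hΔ : ∀ y : ZMod p, y * y ≠ disc M) :
    ∃ a b : ZMod p, b ≠ 0 ∧
      (a • (1 : Mat p 2) + b • M) * (a • (1 : Mat p 2) + b • M) = n • (1 : Mat p 2) := by
  have h2 : (2 : ZMod p) ≠ 0 := two_ne_zero_zmod hp2
  set t : ZMod p := M 0 0 + M 1 1 with ht
  set d : ZMod p := M 0 0 * M 1 1 - M 0 1 * M 1 0 with hd
  have hΔdef : disc M = t ^ 2 - 4 * d := rfl
  have hΔ0 : disc M ≠ 0 := fun h => hΔ 0 (by rw [h, mul_zero])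
  -- `n / disc` is a square
  obtain ⟨r, hr⟩ := isSquare_mul_of_nonsquare hn (nonsquare_inv hΔ)
  refine ⟨-(r * t), 2 * r, mul_ne_zero h2 ?_, ?_⟩
  · rintro rfl
    rw [mul_zero] at hr
    exact mul_ne_zero (fun h => hn 0 (by rw [h, mul_zero])) (inv_ne_zero hΔ0) hr
  have hCH := mat2_sq_eq M
  rw [← ht, ← hd] at hCH
  rw [sq_affine, hCH]
  have key : (r * t) * (r * t) - 4 * (r * r) * d = n := by
    have : r * r = n * (disc M)⁻¹ := hr.symm
    have e2 : r * r * disc M = n := by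
      rw [this, mul_assoc, inv_mul_cancel₀ hΔ0, mul_one]
    rw [hΔdef] at e2
    linear_combination e2
  rw [← key]
  module

/-! ### The standard Singer normaliser -/

/-- The standard generator `[[0, n], [1, 0]]` of `𝔽_p[√n]` inside `M₂(𝔽_p)`. -/
def stdSinger (n : ZMod p) : Mat p 2 := !![0, n; 1, 0]

/-- Entry `(0,0)` of `stdSinger n`. -/
@[simp] theorem stdSinger_apply00 (n : ZMod p) : stdSinger n 0 0 = 0 := rfl
/-- Entry `(0,1)` of `stdSinger n`. -/
@[simp] theorem stdSinger_apply01 (n : ZMod p) : stdSinger n 0 1 = n := rfl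
/-- Entry `(1,0)` of `stdSinger n`. -/
@[simp] theorem stdSinger_apply10 (n : ZMod p) : stdSinger n 1 0 = 1 := rfl
/-- Entry `(1,1)` of `stdSinger n`. -/
@[simp] theorem stdSinger_apply11 (n : ZMod p) : stdSinger n 1 1 = 0 := rfl

/-- The commutant of `[[0, n], [1, 0]]` is shape⁺. -/
theorem isSingerNormal_of_comm_std {n : ZMod p} {x : GLm p 2}
    (h : (x : Mat p 2) * stdSinger n = stdSinger n * (x : Mat p 2)) : IsSingerNormal n x := by
  left
  have e01 := congrArg (fun A : Mat p 2 => A 0 0) h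
  have e11 := congrArg (fun A : Mat p 2 => A 1 0) h
  simp [Matrix.mul_apply, Fin.sum_univ_two] at e01 e11
  exact ⟨by rw [e01], by rw [e11]⟩

/-- The anti-commutant of `[[0, n], [1, 0]]` is shape⁻. -/
theorem isSingerNormal_of_anticomm_std {n : ZMod p} {x : GLm p 2}
    (h : (x : Mat p 2) * stdSinger n = -(stdSinger n * (x : Mat p 2))) : IsSingerNormal n x := by
  right
  have e01 := congrArg (fun A : Mat p 2 => A 0 0) h
  have e11 := congrArg (fun A : Mat p 2 => A 1 0) h
  simp [Matrix.mul_apply, Fin.sum_univ_two] at e01 e11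
  refine ⟨by rw [e01], ?_⟩
  rw [e11]

/-- The matrix with columns `v, w`. -/
def colMat (v w : Fin 2 → ZMod p) : Mat p 2 := !![v 0, w 0; v 1, w 1]

/-- Determinant of the column matrix. -/
theorem colMat_det (v w : Fin 2 → ZMod p) : (colMat v w).det = v 0 * w 1 - w 0 * v 1 := by
  simp [colMat, Matrix.det_fin_two]

/-- First column. -/
theorem colMat_mulVec_e0 (v w : Fin 2 → ZMod p) : (colMat v w).mulVec (Pi.single 0 1) = v := by
  ext i; fin_cases i <;> simp [colMat, Matrix.mulVec, dotProduct, Fin.sum_univ_two]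

/-- Second column. -/
theorem colMat_mulVec_e1 (v w : Fin 2 → ZMod p) : (colMat v w).mulVec (Pi.single 1 1) = w := by
  ext i; fin_cases i <;> simp [colMat, Matrix.mulVec, dotProduct, Fin.sum_univ_two]

/-- Entry `(i, j)` of a matrix is coordinate `i` of its action on `e_j`. -/
theorem apply_eq_mulVec_single (A : Mat p 2) (i j : Fin 2) :
    A i j = A.mulVec (Pi.single j 1) i := by
  rw [Matrix.mulVec_single_one]; rfl

/-- **Conjugating a square root of `n · 1` to the standard one.**  If `s² = n · 1` and `s` is not
scalar, there is `P ∈ GL₂(𝔽_p)` with `s P = P · [[0, n], [1, 0]]`. -/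
theorem exists_conj_stdSinger {n : ZMod p} {s : Mat p 2}
    (hs : s * s = n • (1 : Mat p 2)) (hns : ¬ (s 0 1 = 0 ∧ s 1 0 = 0 ∧ s 1 1 = s 0 0)) :
    ∃ P : GLm p 2, s * (P : Mat p 2) = (P : Mat p 2) * stdSinger n := by
  -- a vector `v` with `v, s v` independent
  obtain ⟨v, hv⟩ : ∃ v : Fin 2 → ZMod p, v 0 * (s.mulVec v) 1 - (s.mulVec v) 0 * v 1 ≠ 0 := by
    by_cases h10 : s 1 0 ≠ 0
    · refine ⟨Pi.single 0 1, ?_⟩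
      simp [Matrix.mulVec, dotProduct, Fin.sum_univ_two]
      exact h10
    by_cases h01 : s 0 1 ≠ 0
    · refine ⟨Pi.single 1 1, ?_⟩
      simp [Matrix.mulVec, dotProduct, Fin.sum_univ_two]
      exact h01
    push Not at h10 h01
    -- `s` diagonal with `s00² = s11² = n`, not scalar: `s11 = -s00 ≠ s00`
    have hne : s 1 1 ≠ s 0 0 := fun h => hns ⟨h01, h10, h⟩
    refine ⟨fun _ => 1, ?_⟩
    simp [Matrix.mulVec, dotProduct, Fin.sum_univ_two, h10, h01]
    exact sub_ne_zero.mpr hne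
  set w := s.mulVec v with hw
  have hsw : s.mulVec w = n • v := by
    rw [hw, Matrix.mulVec_mulVec, hs, Matrix.smul_mulVec, Matrix.one_mulVec]
  have hdet : (colMat v w).det ≠ 0 := by rw [colMat_det]; exact hv
  refine ⟨Matrix.GeneralLinearGroup.mkOfDetNeZero _ hdet, ?_⟩
  show s * colMat v w = colMat v w * stdSinger n
  -- compare the actions on `e₀, e₁`
  ext i j
  fin_cases j
  · have l : (s * colMat v w) i 0 = (s.mulVec v) i := by
      rw [apply_eq_mulVec_single (s * colMat v w) i 0, ← Matrix.mulVec_mulVec, colMat_mulVec_e0]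
    have r : (colMat v w * stdSinger n) i 0 = w i := by
      fin_cases i <;> simp [colMat, stdSinger, Matrix.mul_apply, Fin.sum_univ_two]
    simp only [Fin.zero_eta, Fin.isValue]
    rw [l, r, hw]
  · have l : (s * colMat v w) i 1 = (s.mulVec w) i := by
      rw [apply_eq_mulVec_single (s * colMat v w) i 1, ← Matrix.mulVec_mulVec, colMat_mulVec_e1]
    have r : (colMat v w * stdSinger n) i 1 = n * v i := by
      fin_cases i <;> simp [colMat, stdSinger, Matrix.mul_apply, Fin.sum_univ_two] <;> ring
    simp only [Fin.mk_one, Fin.isValue]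
    rw [l, r, hsw]; simp

/-- Transport of (anti-)commutation along a conjugation `s P = P s₀`:
`x s = ± s x` gives `(P⁻¹ x P) s₀ = ± s₀ (P⁻¹ x P)`. -/
theorem conj_comm_transport {s s₀ : Mat p 2} {P : GLm p 2}
    (hP : s * (P : Mat p 2) = (P : Mat p 2) * s₀) (x : GLm p 2) (ε : ZMod p)
    (hx : (x : Mat p 2) * s = ε • (s * (x : Mat p 2))) :
    ((P⁻¹ * x * P : GLm p 2) : Mat p 2) * s₀ = ε • (s₀ * ((P⁻¹ * x * P : GLm p 2) : Mat p 2)) := by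
  have hPinv : ((P⁻¹ : GLm p 2) : Mat p 2) * (P : Mat p 2) = 1 := by
    rw [← Units.val_mul, inv_mul_cancel, Units.val_one]
  have hs₀ : s₀ = ((P⁻¹ : GLm p 2) : Mat p 2) * s * (P : Mat p 2) := by
    rw [Matrix.mul_assoc, hP, ← Matrix.mul_assoc, hPinv, Matrix.one_mul]
  simp only [Units.val_mul]
  rw [hs₀]
  have hPP : (P : Mat p 2) * ((P⁻¹ : GLm p 2) : Mat p 2) = 1 := by
    rw [← Units.val_mul, mul_inv_cancel, Units.val_one]
  calc ((P⁻¹ : GLm p 2) : Mat p 2) * (x : Mat p 2) * (P : Mat p 2) *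
        (((P⁻¹ : GLm p 2) : Mat p 2) * s * (P : Mat p 2))
        = ((P⁻¹ : GLm p 2) : Mat p 2) * ((x : Mat p 2) * s) * (P : Mat p 2) := by
          simp only [Matrix.mul_assoc]
          rw [← Matrix.mul_assoc (P : Mat p 2), hPP, Matrix.one_mul]
    _ = ((P⁻¹ : GLm p 2) : Mat p 2) * (ε • (s * (x : Mat p 2))) * (P : Mat p 2) := by rw [hx]
    _ = ε • (((P⁻¹ : GLm p 2) : Mat p 2) * s * (P : Mat p 2) *
          (((P⁻¹ : GLm p 2) : Mat p 2) * (x : Mat p 2) * (P : Mat p 2))) := by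
          rw [Matrix.mul_smul, Matrix.smul_mul]
          congr 1
          simp only [Matrix.mul_assoc]
          rw [← Matrix.mul_assoc (P : Mat p 2) ((P⁻¹ : GLm p 2) : Mat p 2), hPP, Matrix.one_mul]

/-! ### Rational eigenbases and the monomial shapes -/

/-- If `x` has `v, w` as eigenvectors then `P⁻¹ x P` is diagonal for `P = [v | w]`. -/
theorem isMonomial_conj_of_eigen {v w : Fin 2 → ZMod p} (hvw : (colMat v w).det ≠ 0)
    {x : GLm p 2} {α β : ZMod p}
    (hv : (x : Mat p 2).mulVec v = α • v) (hw : (x : Mat p 2).mulVec w = β • w) :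
    IsMonomial ((Matrix.GeneralLinearGroup.mkOfDetNeZero _ hvw)⁻¹ * x *
      Matrix.GeneralLinearGroup.mkOfDetNeZero _ hvw) := by
  set P := Matrix.GeneralLinearGroup.mkOfDetNeZero _ hvw with hPdef
  have hP : (P : Mat p 2) = colMat v w := rfl
  have c0 : ((P⁻¹ * x * P : GLm p 2) : Mat p 2).mulVec (Pi.single 0 1) = α • Pi.single 0 1 := by
    simp only [Units.val_mul]
    rw [← Matrix.mulVec_mulVec, ← Matrix.mulVec_mulVec, hP, colMat_mulVec_e0, hv,
      Matrix.mulVec_smul, ← colMat_mulVec_e0 v w, ← hP, inv_mulVec_mulVec]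
  have c1 : ((P⁻¹ * x * P : GLm p 2) : Mat p 2).mulVec (Pi.single 1 1) = β • Pi.single 1 1 := by
    simp only [Units.val_mul]
    rw [← Matrix.mulVec_mulVec, ← Matrix.mulVec_mulVec, hP, colMat_mulVec_e1, hw,
      Matrix.mulVec_smul, ← colMat_mulVec_e1 v w, ← hP, inv_mulVec_mulVec]
  left
  constructor
  · rw [apply_eq_mulVec_single ((P⁻¹ * x * P : GLm p 2) : Mat p 2) 0 1, c1]; simp
  · rw [apply_eq_mulVec_single ((P⁻¹ * x * P : GLm p 2) : Mat p 2) 1 0, c0]; simp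

/-- If `x` swaps the lines of `v` and `w` then `P⁻¹ x P` is anti-diagonal for `P = [v | w]`. -/
theorem isMonomial_conj_of_swap {v w : Fin 2 → ZMod p} (hvw : (colMat v w).det ≠ 0)
    {x : GLm p 2} {α β : ZMod p}
    (hv : (x : Mat p 2).mulVec v = α • w) (hw : (x : Mat p 2).mulVec w = β • v) :
    IsMonomial ((Matrix.GeneralLinearGroup.mkOfDetNeZero _ hvw)⁻¹ * x *
      Matrix.GeneralLinearGroup.mkOfDetNeZero _ hvw) := by
  set P := Matrix.GeneralLinearGroup.mkOfDetNeZero _ hvw with hPdef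
  have hP : (P : Mat p 2) = colMat v w := rfl
  have c0 : ((P⁻¹ * x * P : GLm p 2) : Mat p 2).mulVec (Pi.single 0 1) = α • Pi.single 1 1 := by
    simp only [Units.val_mul]
    rw [← Matrix.mulVec_mulVec, ← Matrix.mulVec_mulVec, hP, colMat_mulVec_e0, hv,
      Matrix.mulVec_smul, ← colMat_mulVec_e1 v w, ← hP, inv_mulVec_mulVec]
  have c1 : ((P⁻¹ * x * P : GLm p 2) : Mat p 2).mulVec (Pi.single 1 1) = β • Pi.single 0 1 := by
    simp only [Units.val_mul]
    rw [← Matrix.mulVec_mulVec, ← Matrix.mulVec_mulVec, hP, colMat_mulVec_e1, hw,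
      Matrix.mulVec_smul, ← colMat_mulVec_e0 v w, ← hP, inv_mulVec_mulVec]
  right
  constructor
  · rw [apply_eq_mulVec_single ((P⁻¹ * x * P : GLm p 2) : Mat p 2) 0 0, c0]; simp
  · rw [apply_eq_mulVec_single ((P⁻¹ * x * P : GLm p 2) : Mat p 2) 1 1, c1]; simp

end PfreeAlgebra

end Summit.MatrixMultiplication.MatrixMultiplication.Theorems.SubgroupIdentityDesigns.Negative

end
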